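/-
Origin: expansion seat `planner-pub-hodgecm-mc-sanity-1-0`, handover #1r 2026-08-18T18:55Z md5 ff70a5cab255b9b54d3be2de7c40f7f3 SUPERSEDES 9ddeab224b4a (doc-only; NEW additive leaf, 307 l.; imports HodgeCM.Model.Sanity.DegenerateCores (row 1 as targeted, no rewrite) + tree HodgeCM.Model.ToyG2.ThetaModelEmb3/ThetaModel3/ThetaUiso/NoEndState3) (`HOME/mc/pub-hodgecm-mc-sanity-1/lean/Toy3Cores.lean`, md5 ff70a5ca, 307 lines);
landed by the packager successor (mc-unitary-1-g3, gen-8 kit) in gate run 32 as `HodgeCM/Model/Sanity/Toy3Cores.lean` (verbatim).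
-/
/-
HodgeCM / MODEL-CONSTRUCTION sub-cell (pub-hodgecm), node SAN — construction prover `pub-hodgecm-mc-sanity-1`
(seat planner-pub-hodgecm-mc-sanity-1-0), 2026-08-18.  Intended PKG path: `HodgeCM/Model/Sanity/Toy3Cores.lean`.
Imports `Sanity/DegenerateCores.lean` (this seat) and the PKG toy files BY NAME; nothing restated, no new axioms,
no hypotheses records, 0 proof holes.  TOY-MODEL file: nothing here is a "cited fact"; every statement is a kernel theorem
about `toyUniverse₃ d t` (REFEREE-mc1 §0 A4: sanity instances).
-/
import Summits.HodgeConjecture.HodgeCM.Model.Sanity.DegenerateCores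
import Summits.HodgeConjecture.HodgeCM.Model.ToyG2.ThetaModelEmb3
import Summits.HodgeConjecture.HodgeCM.Model.ToyG2.ThetaModel3
import Summits.HodgeConjecture.HodgeCM.Model.ToyG2.ThetaUiso_2
import Summits.HodgeConjecture.HodgeCM.Model.ToyG2.NoEndState3

/-!
# Sanity: the E2 record instantiated on the exterior-algebra toy `toyUniverse₃ d t`

The E2 deliverable (MODEL-DAG §2c) is a record `(C : U.AdelicThetaCore₀, AllCharsNonDesign (C.thetaModelArch h w12 w34))`.
This file INSTANTIATES the record type on the PKG toy universe `U := toyUniverse₃ d t` (`1 ≤ d`, `t² = 16`) with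
two cores built from the toy's own data, and DECIDES each of the seven inputs C1–C7 for each (for every `h`, every
pair of side data `d12`/`d34`, hence in particular for `thetaModelArch h w12 w34 = thetaModel h (side w12) (side w34)`,
and for every `hP`, in particular `printFact_unitaryCompact_holds`):

* `nullCore₃` — ALL-ZERO data (`emb := 0`, `cover := id`, degenerate `wm`, `Theta := ∅`):
  **C1 ✓ C2 ✗ C3 ✓ C4 ✗ C5 ✓ C6 ✓ C7 ✓** (`nullCore₃_profile`).  C2 fails because a period surface of the toy
  carries a `(2,0)`-class of nonzero Petersson norm (`thetaModel₃_exists_petersson_ne_zero`, toy-g5/pv03); C4 fails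
  for every universe (`DegenerateCores`).  FIVE of the seven inputs are met by zero data.
* `gramCore₃ J` — the toy's GEOMETRIC content (`emb := J_V ∘ hr3g_Lam`, the Gram map of toy-g5 followed by an
  arbitrary linear map `J_V : HG L ι₁ →ₗ[ℂ] H_V = L²([G_U])` supplied as DATA; `cover := id`; `Theta := thetaSet₃`, the
  single-eigenvector theta classes of `ThetaUiso`) but DEGENERATE analytic content (`wm :=` degenerate):
  **C1 ✓, C3 ✓, C4 ✓, C6 ✓, C7 ✓ unconditionally; C2 ✓ whenever every `J_V` preserves inner products
  (`c_Γ = ¼`, toy-g5's Gram identity `hr3g_gram`); and C5 ⟹ `J_V` KILLS A NONZERO VECTOR at every good context**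
  (`Λ(E₀, E₁) ≠ 0`, `ThetaModel3.Λ_thetaE01_ne_zero`) — so C5 ✗ as soon as one `J_V` at a good context is injective,
  in particular under the inner-product hypothesis that gives C2 (`gramCore₃_profile`).
  Moreover C2 alone already forces `J_V ≠ 0` on the theta Gram vector of every block of every context
  (`gramCore₃_innerEmb_forces_J_ne_zero`) — ALSO at off-regime `V`, where `[G_U]` is one point
  (`DegenerateCores` §5): the kernel form of the MODEL-SCOPE A.3 corner for the unguarded C2.

For the record (other END-STATE binders on this toy, PKG theorems by name): `U.Fact_hodgeRiemann20` FAILS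
(`NoEndState3.toyUniverse₃_not_hodgeRiemann20`) while `U.ModelAxioms ∧ … ∧ U.PerL ∧ U.HC_CM` HOLD
(`toyUniverse₃_profile_cmInflation`) — so `perL_ofSignRecipe₇` can never be APPLIED in this toy (its `hHR` is false),
consistently with `PerL` holding there for other reasons; the toy adjudicates the seven inputs individually, not E.
-/

set_option autoImplicit false

noncomputable section

open HodgeCM HodgeCM.Universe HodgeCM.ToyG2 HodgeCM.ToyG2.ThetaUiso MeasureTheory
open scoped InnerProductSpace
open Literature.AlgebraicGeometry.Motives (HodgeStructure)
open Literature.AlgebraicGeometry.Motives.HodgeStructure (conj)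

attribute [-instance] Quotient.instMeasurableSpace

namespace HodgeCM.Sanity.Toy3

variable (d t : ℚ) (hd : (1 : ℚ) ≤ d) (ht : t ^ 2 = 16) (hP : PrintFact_unitaryCompact) (h : Bool)
variable (d12 d34 : ∀ {L : CMField}, SeesawCtx L → SideData L)

/-! ## §1 The all-zero core -/

/-- **The ALL-ZERO core** on `toyUniverse₃ d t`: `emb := 0`, `cover := id`, degenerate Weil theta models, `Theta := ∅`. -/
def nullCore₃ : (toyUniverse₃ d t).AdelicThetaCore hP where
  emb := fun _ => 0
  cover := fun Γ _ _ => (toyUniverse₃ d t).idMor ((toyUniverse₃ d t).pms _ _ _ Γ)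
  wm := fun _ _ => degenerateWeilThetaModel _ _ _ _
  Theta := fun _ _ _ _ => ∅

/-- (Ported verbatim from the HodgeCMPerL package; no docstring in the source.) -/
theorem nullCore₃_zeroEmb : (nullCore₃ d t hP).ZeroEmb := fun _ => rfl

/-- (Ported verbatim from the HodgeCMPerL package; no docstring in the source.) -/
theorem nullCore₃_emptyTheta : (nullCore₃ d t hP).EmptyTheta := fun _ _ _ _ => rfl

/-- (Ported verbatim from the HodgeCMPerL package; no docstring in the source.) -/
theorem nullCore₃_zeroKernels : (nullCore₃ d t hP).ZeroKernels := fun _ _ Φ => degenerateWeilThetaModel_θ _ _ _ _ Φ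

/-- C1 ✓ -/
theorem nullCore₃_embCover : ((nullCore₃ d t hP).thetaModel h d12 d34).Fact_embCover :=
  AdelicThetaCore.fact_embCover_of_zeroEmb h d12 d34 (nullCore₃_zeroEmb d t hP)

include hd ht in
/-- **C2 ✗** — the zero embedding cannot satisfy the Petersson identity: some period surface of `toyUniverse₃ d t`
carries a `(2,0)`-class `η` with `tr_ℂ(η ∪ η̄) ≠ 0` (`thetaModel₃_exists_petersson_ne_zero`). -/
theorem not_nullCore₃_innerEmb : ¬ ((nullCore₃ d t hP).thetaModel h d12 d34).Fact_innerEmb := by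
  rw [AdelicThetaCore.fact_innerEmb_iff_of_zeroEmb h d12 d34 (nullCore₃_zeroEmb d t hP)]
  intro H
  obtain ⟨F, ι₁, V, Γ, η, hF, -, htr⟩ := thetaModel₃_exists_petersson_ne_zero d t hd ht
  exact htr (H Γ η η hF hF)

/-- C3 ✓ -/
theorem nullCore₃_thetaSub : ((nullCore₃ d t hP).thetaModel h d12 d34).Open_thetaSub :=
  AdelicThetaCore.open_thetaSub_of_emptyTheta h d12 d34 (nullCore₃_emptyTheta d t hP)

/-- **C4 ✗** (as for every universe: good contexts exist, `Θ₀ = ∅`). -/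
theorem not_nullCore₃_thetaWedge : ¬ ((nullCore₃ d t hP).thetaModel h d12 d34).Open_thetaWedge :=
  AdelicThetaCore.not_open_thetaWedge_of_emptyTheta h d12 d34 (nullCore₃_emptyTheta d t hP)

/-- C5 ✓ (vacuously: no theta one-forms; independently: zero kernels and zero embedding). -/
theorem nullCore₃_thetaGen12All : ((nullCore₃ d t hP).thetaModel h d12 d34).Open_thetaGen12All :=
  AdelicThetaCore.open_thetaGen12All_of_emptyTheta h d12 d34 (nullCore₃_emptyTheta d t hP)

/-- C6 ✓ -/
theorem nullCore₃_thetaReal34All : ((nullCore₃ d t hP).thetaModel h d12 d34).Open_thetaReal34All :=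
  AdelicThetaCore.open_thetaReal34All_of_zeroKernels h d12 d34 (nullCore₃_zeroKernels d t hP)

/-- C7 ✓ -/
theorem nullCore₃_occ : ((nullCore₃ d t hP).thetaModel h d12 d34).Open_occ :=
  AdelicThetaCore.open_occ_of_zeroKernels h d12 d34 (nullCore₃_zeroKernels d t hP)

include hd ht in
/-- **PROFILE of the all-zero core: C1 ✓ C2 ✗ C3 ✓ C4 ✗ C5 ✓ C6 ✓ C7 ✓.** -/
theorem nullCore₃_profile :
    ((nullCore₃ d t hP).thetaModel h d12 d34).Fact_embCover ∧
    ¬ ((nullCore₃ d t hP).thetaModel h d12 d34).Fact_innerEmb ∧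
    ((nullCore₃ d t hP).thetaModel h d12 d34).Open_thetaSub ∧
    ¬ ((nullCore₃ d t hP).thetaModel h d12 d34).Open_thetaWedge ∧
    ((nullCore₃ d t hP).thetaModel h d12 d34).Open_thetaGen12All ∧
    ((nullCore₃ d t hP).thetaModel h d12 d34).Open_thetaReal34All ∧
    ((nullCore₃ d t hP).thetaModel h d12 d34).Open_occ :=
  ⟨nullCore₃_embCover d t hP h d12 d34, not_nullCore₃_innerEmb d t hd ht hP h d12 d34,
    nullCore₃_thetaSub d t hP h d12 d34, not_nullCore₃_thetaWedge d t hP h d12 d34,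
    nullCore₃_thetaGen12All d t hP h d12 d34, nullCore₃_thetaReal34All d t hP h d12 d34, nullCore₃_occ d t hP h d12 d34⟩

/-- hence the all-zero core is NOT an E2 record (two of seven inputs fail). -/
theorem not_nullCore₃_allCharsNonDesign : ¬ ((nullCore₃ d t hP).thetaModel h d12 d34).AllCharsNonDesign :=
  fun A => not_nullCore₃_thetaWedge d t hP h d12 d34 A.thetaWedge

/-! ## §2 The Gram core: the toy's geometric content, degenerate analytic content -/

/-- A family of linear "transfer" maps from the toy's Gram space `HG L ι₁` to the model Hilbert space
`H_V = L²([G_U])` of each context — explicit DATA of the Gram core (e.g. `0`); its properties (preserving inner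
products, injectivity) are HYPOTHESES of the theorems below, never asserted. -/
abbrev Transfer : Type _ :=
  ∀ {L : CMField} {ι₁ : L →+* ℂ} (V : HermSpace3 L ι₁), HG L ι₁ →ₗ[ℂ] (V.latticeModel hP).toQuotientModel.H

variable (J : Transfer hP)

/-- **The GRAM core** on `toyUniverse₃ d t`: `emb := J_V ∘ hr3g_Lam` (toy-g5's Gram map into `HG L ι₁`, transferred
to `H_V` by `J_V`), `cover := id`, DEGENERATE Weil theta models, `Theta := thetaSet₃` (ThetaUiso's theta classes). -/
def gramCore₃ : (toyUniverse₃ d t).AdelicThetaCore hP where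
  emb := fun {_} {ι₁} {V} Γ => (J V).comp (hr3g_Lam d t ι₁ Γ hd ht)
  cover := fun Γ _ _ => (toyUniverse₃ d t).idMor ((toyUniverse₃ d t).pms _ _ _ Γ)
  wm := fun _ _ => degenerateWeilThetaModel _ _ _ _
  Theta := fun {_} {ι₁} V c i Γ => thetaSet₃ d t ι₁ V c i Γ

/-- (Ported verbatim from the HodgeCMPerL package; no docstring in the source.) -/
theorem gramCore₃_emb {L : CMField} {ι₁ : L →+* ℂ} {V : HermSpace3 L ι₁} (Γ : Level V)
    (η : (toyUniverse₃ d t).CohC ((toyUniverse₃ d t).pms L ι₁ V Γ) 2) :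
    (gramCore₃ d t hd ht hP J).emb Γ η = J V (hr3g_Lam d t ι₁ Γ hd ht η) := rfl

/-- (Ported verbatim from the HodgeCMPerL package; no docstring in the source.) -/
theorem gramCore₃_Theta {L : CMField} {ι₁ : L →+* ℂ} (V : HermSpace3 L ι₁) (c : SeesawCtx L) (i : Fin 4)
    (Γ : Level V) : (gramCore₃ d t hd ht hP J).Theta V c i Γ = thetaSet₃ d t ι₁ V c i Γ := rfl

/-- (Ported verbatim from the HodgeCMPerL package; no docstring in the source.) -/
theorem gramCore₃_zeroKernels : (gramCore₃ d t hd ht hP J).ZeroKernels :=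
  fun _ _ Φ => degenerateWeilThetaModel_θ _ _ _ _ Φ

/-- **C1 ✓** (`cover = id`, pull-back along the identity is the identity: `pullC_idMor_pms₃_two`). -/
theorem gramCore₃_embCover : ((gramCore₃ d t hd ht hP J).thetaModel h d12 d34).Fact_embCover :=
  ((gramCore₃ d t hd ht hP J).thetaModel_embCover_iff h d12 d34).mpr fun {L} {ι₁} {V} Γ Γ' _ η => by
    show J V (hr3g_Lam d t ι₁ Γ' hd ht ((toyUniverse₃ d t).pullC (X := (toyUniverse₃ d t).pms L ι₁ V Γ')
      (Y := (toyUniverse₃ d t).pms L ι₁ V Γ) ((toyUniverse₃ d t).idMor ((toyUniverse₃ d t).pms L ι₁ V Γ)) 2 η))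
        = J V (hr3g_Lam d t ι₁ Γ hd ht η)
    rw [pullC_idMor_pms₃_two]
    rfl

/-- **C2 at one context**: if `J_V` preserves inner products then the Petersson identity holds at every level of
`(L, ι₁, V)` with `c_Γ = ¼` (toy-g5's Gram identity `hr3g_gram`: `tr_ℂ(x ∪ ȳ) = 4⟪Λ y, Λ x⟫` on `F²H²`). -/
theorem gramCore₃_innerEmbAt {L : CMField} {ι₁ : L →+* ℂ} (V : HermSpace3 L ι₁)
    (hJ : ∀ x y : HG L ι₁, ⟪J V x, J V y⟫_ℂ = ⟪x, y⟫_ℂ) (Γ : Level V) :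
    ∃ a : ℂ, a ≠ 0 ∧ ∀ η η' : (toyUniverse₃ d t).CohC ((toyUniverse₃ d t).pms L ι₁ V Γ) 2,
      η ∈ ((toyUniverse₃ d t).hodge ((toyUniverse₃ d t).pms L ι₁ V Γ) 2).F 2 →
      η' ∈ ((toyUniverse₃ d t).hodge ((toyUniverse₃ d t).pms L ι₁ V Γ) 2).F 2 →
        ⟪(gramCore₃ d t hd ht hP J).emb Γ η', (gramCore₃ d t hd ht hP J).emb Γ η⟫_ℂ =
          a * (toyUniverse₃ d t).trC ((toyUniverse₃ d t).pms L ι₁ V Γ) 4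
            ((toyUniverse₃ d t).cup2C ((toyUniverse₃ d t).pms L ι₁ V Γ) 2 η (conj η')) := by
  refine ⟨(1 / 4 : ℂ), by norm_num, fun η η' hη hη' => ?_⟩
  rw [gramCore₃_emb, gramCore₃_emb, hJ, hr3g_gram d t ι₁ Γ hd ht hη hη']
  ring

/-- **C2 ✓ under the (data-level) hypothesis that every `J_V` preserves inner products.**  CAVEAT (MODEL-SCOPE A.3
CORNER, `DegenerateCores` §5): C2 is unguarded, and at an off-regime `V` the target `H_V` is `L²` of a one-point space,
so this hypothesis is satisfiable only where `HG L ι₁ = 0` or `V` is in the anisotropic regime. -/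
theorem gramCore₃_innerEmb
    (hJ : ∀ {L : CMField} {ι₁ : L →+* ℂ} (V : HermSpace3 L ι₁) (x y : HG L ι₁), ⟪J V x, J V y⟫_ℂ = ⟪x, y⟫_ℂ) :
    ((gramCore₃ d t hd ht hP J).thetaModel h d12 d34).Fact_innerEmb :=
  ((gramCore₃ d t hd ht hP J).thetaModel_innerEmb_iff h d12 d34).mpr fun {_} {_} {V} Γ =>
    gramCore₃_innerEmbAt d t hd ht hP J V (hJ V) Γ

/-- **C2 forces `J_V ≠ 0` on the theta Gram vector of EVERY block of EVERY context** — including off-regime `V`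
(where `[G_U]` is one point, `DegenerateCores.subsingleton_quotient_of_not_isAnisotropic`). -/
theorem gramCore₃_innerEmb_forces_J_ne_zero (hC2 : ((gramCore₃ d t hd ht hP J).thetaModel h d12 d34).Fact_innerEmb)
    {L : CMField} {ι₁ : L →+* ℂ} (V : HermSpace3 L ι₁) (Γ : Level V) (k : Fin (nQ L ι₁)) :
    J V (hr3g_Lam d t ι₁ Γ hd ht (theta23Cls₃ d t ι₁ k Γ)) ≠ 0 := by
  rw [(gramCore₃ d t hd ht hP J).thetaModel_innerEmb_iff h d12 d34] at hC2
  obtain ⟨a, ha, H⟩ := hC2 Γ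
  have hid := H (theta23Cls₃ d t ι₁ k Γ) (theta23Cls₃ d t ι₁ k Γ) (theta23Cls₃_mem_F2 d t ι₁ k Γ)
    (theta23Cls₃_mem_F2 d t ι₁ k Γ)
  rw [gramCore₃_emb] at hid
  intro h0
  rw [h0, inner_zero_left] at hid
  exact (mul_ne_zero ha (thetaModel₃_petersson_ne_zero d t hd ht ι₁ k Γ)) hid.symm

/-- **C3 ✓** (theta classes are isotypic: `thetaSet_sub_uiso₃`). -/
theorem gramCore₃_thetaSub : ((gramCore₃ d t hd ht hP J).thetaModel h d12 d34).Open_thetaSub :=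
  open_thetaSub_of_theta_eq₃ d t _ fun _ _ _ _ => rfl

/-- **C4 ✓** (the `(Ψ₀, Ψ₁)` theta wedge is a nonzero class: `thetaSet_wedge₃`). -/
theorem gramCore₃_thetaWedge : ((gramCore₃ d t hd ht hP J).thetaModel h d12 d34).Open_thetaWedge :=
  open_thetaWedge_of_theta_eq₃ d t _ fun _ _ _ _ => rfl

/-- **C5 for the Gram core ⟺ `J_V` kills the Gram image `Λ(ω₁, ω₂)` of every theta wedge of every good context.** -/
theorem gramCore₃_thetaGen12All_iff :
    ((gramCore₃ d t hd ht hP J).thetaModel h d12 d34).Open_thetaGen12All ↔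
      ∀ {L : CMField} {ι₁ : L →+* ℂ} (V : HermSpace3 L ι₁) (c : SeesawCtx L), SignRecipe.GoodCtx h ι₁ c →
        ∀ (Γ : Level V) (ω₁ ω₂ : (toyUniverse₃ d t).CohC ((toyUniverse₃ d t).pms L ι₁ V Γ) 1),
          ω₁ ∈ thetaSet₃ d t ι₁ V c 0 Γ → ω₂ ∈ thetaSet₃ d t ι₁ V c 1 Γ → J V (Λ ι₁ d t hd ht ω₁ ω₂) = 0 := by
  rw [AdelicThetaCore.open_thetaGen12All_iff_of_zeroKernels h d12 d34 (gramCore₃_zeroKernels d t hd ht hP J)]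
  refine ⟨fun H L ι₁ V c hc Γ ω₁ ω₂ h₁ h₂ => ?_, fun H L ι₁ V c hc Γ ω₁ ω₂ h₁ h₂ => ?_⟩
  · have h0 := H V c hc Γ ω₁ ω₂ h₁ h₂
    rwa [gramCore₃_emb, hr3g_Lam_cup] at h0
  · rw [gramCore₃_emb, hr3g_Lam_cup]
    exact H V c hc Γ ω₁ ω₂ h₁ h₂

/-- **C5 ⟹ `J_V` kills a NONZERO vector at every good context** (the theta wedge `Λ(E₀, E₁) ≠ 0` of
`ThetaModel3.Λ_thetaE01_ne_zero`): the all-characters generation input DETECTS the degenerate Weil theta model as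
soon as the transfer `J_V` is injective at one good context. -/
theorem gramCore₃_thetaGen12All_kills (hC5 : ((gramCore₃ d t hd ht hP J).thetaModel h d12 d34).Open_thetaGen12All)
    {L : CMField} {ι₁ : L →+* ℂ} (V : HermSpace3 L ι₁) (c : SeesawCtx L) (hc : SignRecipe.GoodCtx h ι₁ c) :
    ∃ x : HG L ι₁, x ≠ 0 ∧ J V x = 0 := by
  obtain ⟨j, hj, -⟩ := hc.forced
  have hm : ∀ i, ι₁.comp j ∈ (c.Ψ i).1 := fun i => hj ▸ hc.mem i
  obtain ⟨Γ⟩ := Level.nonempty V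
  refine ⟨Λ ι₁ d t hd ht (thetaE d t ι₁ j c.Ψ hc.pairSum hm 0) (thetaE d t ι₁ j c.Ψ hc.pairSum hm 1),
    Λ_thetaE01_ne_zero d t ι₁ hd ht j c.Ψ hc.pairSum hm, ?_⟩
  exact (gramCore₃_thetaGen12All_iff d t hd ht hP h d12 d34 J).mp hC5 V c hc Γ _ _
    ⟨j, hc.pairSum, hm, hj, rfl⟩ ⟨j, hc.pairSum, hm, hj, rfl⟩

/-- **C5 ✗ whenever some `J_V` at a good context is injective** — in particular whenever all `J_V` are injective,
since good contexts exist (`DegenerateCores.exists_signRecipe_goodCtx`). -/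
theorem not_gramCore₃_thetaGen12All
    (hJ : ∀ {L : CMField} {ι₁ : L →+* ℂ} (V : HermSpace3 L ι₁), Function.Injective (J V)) :
    ¬ ((gramCore₃ d t hd ht hP J).thetaModel h d12 d34).Open_thetaGen12All := by
  intro hC5
  obtain ⟨F, ι₁, V, c, hc⟩ := AdelicThetaCore.exists_signRecipe_goodCtx h (gramCore₃ d t hd ht hP J) d12 d34
  obtain ⟨x, hx, h0⟩ := gramCore₃_thetaGen12All_kills d t hd ht hP h d12 d34 J hC5 V c hc
  exact hx (hJ V (h0.trans (map_zero (J V)).symm))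

/-- **C6 ✓** (zero kernels). -/
theorem gramCore₃_thetaReal34All : ((gramCore₃ d t hd ht hP J).thetaModel h d12 d34).Open_thetaReal34All :=
  AdelicThetaCore.open_thetaReal34All_of_zeroKernels h d12 d34 (gramCore₃_zeroKernels d t hd ht hP J)

/-- **C7 ✓** (zero kernels). -/
theorem gramCore₃_occ : ((gramCore₃ d t hd ht hP J).thetaModel h d12 d34).Open_occ :=
  AdelicThetaCore.open_occ_of_zeroKernels h d12 d34 (gramCore₃_zeroKernels d t hd ht hP J)

/-- inner-product preservation gives injectivity -/
theorem injective_of_inner {L : CMField} {ι₁ : L →+* ℂ} (V : HermSpace3 L ι₁)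
    (hJ : ∀ x y : HG L ι₁, ⟪J V x, J V y⟫_ℂ = ⟪x, y⟫_ℂ) : Function.Injective (J V) := by
  intro x y hxy
  have h0 : ⟪x - y, x - y⟫_ℂ = 0 := by
    rw [← hJ, map_sub, hxy, sub_self, inner_zero_left]
  exact sub_eq_zero.mp (inner_self_eq_zero.mp h0)

/-- **PROFILE of the Gram core with inner-product-preserving transfer: C1 ✓ C2 ✓ C3 ✓ C4 ✓ C5 ✗ C6 ✓ C7 ✓** —
with honest geometric content the all-characters generation input C5 is the ONE input that detects the degenerate
Weil theta model; C6 and C7 do not. -/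
theorem gramCore₃_profile
    (hJ : ∀ {L : CMField} {ι₁ : L →+* ℂ} (V : HermSpace3 L ι₁) (x y : HG L ι₁), ⟪J V x, J V y⟫_ℂ = ⟪x, y⟫_ℂ) :
    ((gramCore₃ d t hd ht hP J).thetaModel h d12 d34).Fact_embCover ∧
    ((gramCore₃ d t hd ht hP J).thetaModel h d12 d34).Fact_innerEmb ∧
    ((gramCore₃ d t hd ht hP J).thetaModel h d12 d34).Open_thetaSub ∧
    ((gramCore₃ d t hd ht hP J).thetaModel h d12 d34).Open_thetaWedge ∧
    ¬ ((gramCore₃ d t hd ht hP J).thetaModel h d12 d34).Open_thetaGen12All ∧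
    ((gramCore₃ d t hd ht hP J).thetaModel h d12 d34).Open_thetaReal34All ∧
    ((gramCore₃ d t hd ht hP J).thetaModel h d12 d34).Open_occ :=
  ⟨gramCore₃_embCover d t hd ht hP h d12 d34 J, gramCore₃_innerEmb d t hd ht hP h d12 d34 J hJ,
    gramCore₃_thetaSub d t hd ht hP h d12 d34 J, gramCore₃_thetaWedge d t hd ht hP h d12 d34 J,
    not_gramCore₃_thetaGen12All d t hd ht hP h d12 d34 J fun V => injective_of_inner hP J V (hJ V),
    gramCore₃_thetaReal34All d t hd ht hP h d12 d34 J, gramCore₃_occ d t hd ht hP h d12 d34 J⟩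

/-- **Unconditionally (any transfer `J`), the Gram core is NOT an E2 record**: C2 and C5 cannot hold together —
C2 needs `J_V` faithful on Gram vectors, C5 needs `J_V` to kill one (at a good context; both are theta Gram vectors of
the same space `HG L ι₁`, and C2's Petersson identity makes `J_V` injective on the whole Gram image `Λ(F¹ ⊗ F¹) ∋ Λ(E₀,E₁)`). -/
theorem not_gramCore₃_allCharsNonDesign : ¬ ((gramCore₃ d t hd ht hP J).thetaModel h d12 d34).AllCharsNonDesign := by
  intro A
  obtain ⟨F, ι₁, V, c, hc⟩ := AdelicThetaCore.exists_signRecipe_goodCtx h (gramCore₃ d t hd ht hP J) d12 d34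
  obtain ⟨j, hj, -⟩ := hc.forced
  have hm : ∀ i, ι₁.comp j ∈ (c.Ψ i).1 := fun i => hj ▸ hc.mem i
  obtain ⟨Γ⟩ := Level.nonempty V
  -- C2 at level Γ: ⟪J Λ η', J Λ η⟫ = a · tr(η ∪ η̄') on F², a ≠ 0
  obtain ⟨a, ha, H⟩ := ((gramCore₃ d t hd ht hP J).thetaModel_innerEmb_iff h d12 d34).mp A.innerEmb Γ
  -- the theta wedge η := E₀ ∪ E₁ ∈ F²: its Gram vector Λ(E₀,E₁) ≠ 0 is killed by J (C5), yet
  -- ⟪J Λ η, J Λ η⟫ = a · tr(η ∪ η̄) = a · 4‖Λ(E₀,E₁)‖² ≠ 0 (C2 + hr3g_gram): contradiction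
  have h₁ : thetaE d t ι₁ j c.Ψ hc.pairSum hm 0 ∈ thetaSet₃ d t ι₁ V c 0 Γ := ⟨j, hc.pairSum, hm, hj, rfl⟩
  have h₂ : thetaE d t ι₁ j c.Ψ hc.pairSum hm 1 ∈ thetaSet₃ d t ι₁ V c 1 Γ := ⟨j, hc.pairSum, hm, hj, rfl⟩
  have hkill : J V (Λ ι₁ d t hd ht (thetaE d t ι₁ j c.Ψ hc.pairSum hm 0) (thetaE d t ι₁ j c.Ψ hc.pairSum hm 1)) = 0 :=
    (gramCore₃_thetaGen12All_iff d t hd ht hP h d12 d34 J).mp A.thetaGen12All V c hc Γ _ _ h₁ h₂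
  have hne : Λ ι₁ d t hd ht (thetaE d t ι₁ j c.Ψ hc.pairSum hm 0) (thetaE d t ι₁ j c.Ψ hc.pairSum hm 1) ≠ 0 :=
    Λ_thetaE01_ne_zero d t ι₁ hd ht j c.Ψ hc.pairSum hm
  have hη : (toyUniverse₃ d t).cup2C ((toyUniverse₃ d t).pms F ι₁ V Γ) 1 (thetaE d t ι₁ j c.Ψ hc.pairSum hm 0)
      (thetaE d t ι₁ j c.Ψ hc.pairSum hm 1) ∈ ((toyUniverse₃ d t).hodge ((toyUniverse₃ d t).pms F ι₁ V Γ) 2).F 2 :=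
    Universe.cup2C_mem_F2 (toyUniverse₃_modelAxioms_all d t) _
      (hr3_eCls_mem_H10 d t ι₁ Γ (qΨ ι₁ j c.Ψ hc.pairSum hm) 0) (hr3_eCls_mem_H10 d t ι₁ Γ (qΨ ι₁ j c.Ψ hc.pairSum hm) 1)
  have hid := H _ _ hη hη
  rw [gramCore₃_emb, hr3g_Lam_cup, hkill, inner_zero_left, hr3g_gram d t ι₁ Γ hd ht hη hη, hr3g_Lam_cup] at hid
  exact (mul_ne_zero ha (mul_ne_zero (by norm_num) (inner_self_ne_zero.mpr hne))) hid.symm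

end HodgeCM.Sanity.Toy3

end
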